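import Summits.Parity.GeneralizedHardyLittlewood.Theorems.LiouvilleShiftedTablesSieveToMAvgCoreHB
import Literature.NumberTheory.Sieve.MoebiusShiftedPrimesLiouville

/-!
# Sieve glue for `SieveToMAvg`, part 11a: from `μ` on dilated shifted primes to the core sums

Support file for item stmt-Parity-14274 (route `LiouvilleShiftedTables`).  The terminal node `MAvg`
concerns `S_m(x) = ∑_{d ≤ x/m} μ(d) Λ(dm + h)`.  Writing `μ(d) = ∑_{k² ∣ d} μ(k) λ(d/k²)`
(`Literature.NumberTheory.Sieve.Lichtman2020.moebius_eq_sum_sq_dvd`) gives `S_m(x) = ∑_k μ(k) R_{k²m}(x)` with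
`R_q(x) = ∑_{d ≤ x/q} λ(d) Λ(dq + h)` (`innerS_eq_sum`), and the substitution `n = dq + h` together
with `λ(dq) = λ(d) λ(q)` shows `|R_q(x)| ≤ |T(x + h; q, h)|` (`abs_Rq_le_abs_Tcorr`).
-/

namespace Summit.Parity.GeneralizedHardyLittlewood.Theorems.SieveToMAvg

open Finset Real
open scoped ArithmeticFunction.zeta ArithmeticFunction.sigma ArithmeticFunction.vonMangoldt
  ArithmeticFunction.Moebius
open Literature.NumberTheory.Sieve.BFI

/-- `S_m(x) = ∑_{d ≤ x/m} μ(d) Λ(dm + h)` (the inner sum of `MAvg`). [folklore] -/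
noncomputable def innerS (h m : ℕ) (x : ℝ) : ℝ :=
  ∑ d ∈ Icc 1 ⌊x / m⌋₊, (μ d : ℝ) * Λ (d * m + h)

/-- `R_q(x) = ∑_{d ≤ x/q} λ(d) Λ(dq + h)`. [folklore] -/
noncomputable def Rq (h q : ℕ) (x : ℝ) : ℝ :=
  ∑ d ∈ Icc 1 ⌊x / q⌋₊, (ArithmeticFunction.liouville d : ℝ) * Λ (d * q + h)

/-- **`S_m = ∑_k μ(k) R_{k²m}`**:
`S_m(x) = ∑_{k ≤ ⌊x/m⌋} μ(k) R_{k²m}(x)`. [folklore] -/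
theorem innerS_eq_sum (h m : ℕ) (x : ℝ) :
    innerS h m x = ∑ k ∈ Icc 1 ⌊x / m⌋₊, (μ k : ℝ) * Rq h (k ^ 2 * m) x := by
  classical
  set D := ⌊x / m⌋₊ with hD
  have hfloor : ∀ k : ℕ, ⌊x / ((k ^ 2 * m : ℕ) : ℝ)⌋₊ = D / k ^ 2 := by
    intro k
    rw [hD, ← Nat.floor_div_natCast]
    congr 1; push_cast; rw [div_div, mul_comm]
  unfold innerS
  have hR : ∀ k ∈ Icc 1 D, (μ k : ℝ) * Rq h (k ^ 2 * m) x =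
      ∑ d' ∈ Icc 1 (D / k ^ 2), (μ k : ℝ) * ((ArithmeticFunction.liouville d' : ℝ) * Λ (d' * (k ^ 2 * m) + h)) := by
    intro k _
    unfold Rq
    rw [hfloor k, Finset.mul_sum]
  rw [Finset.sum_congr rfl hR]
  have hμ : ∀ d ∈ Icc 1 D, (μ d : ℝ) * Λ (d * m + h) =
      ∑ k ∈ (Icc 1 d).filter (fun k => k ^ 2 ∣ d),
        (μ k : ℝ) * (ArithmeticFunction.liouville (d / k ^ 2) : ℝ) * Λ (d * m + h) := by
    intro d hd
    have hd1 : 0 < d := (Finset.mem_Icc.1 hd).1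
    rw [Literature.NumberTheory.Sieve.Lichtman2020.moebius_eq_sum_sq_dvd hd1]
    push_cast
    rw [Finset.sum_mul]
  rw [Finset.sum_congr rfl hμ, Finset.sum_sigma', Finset.sum_sigma']
  refine Finset.sum_bij' (fun p _ => (⟨p.2, p.1 / p.2 ^ 2⟩ : Σ _ : ℕ, ℕ))
    (fun p _ => (⟨p.2 * p.1 ^ 2, p.1⟩ : Σ _ : ℕ, ℕ)) ?_ ?_ ?_ ?_ ?_
  · rintro ⟨d, k⟩ hp
    simp only [Finset.mem_sigma, Finset.mem_filter, Finset.mem_Icc] at hp ⊢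
    obtain ⟨⟨hd1, hdD⟩, ⟨hk1, hkd⟩, hkdvd⟩ := hp
    have hk0 : 0 < k ^ 2 := by positivity
    exact ⟨⟨hk1, hkd.trans hdD⟩, Nat.div_pos (Nat.le_of_dvd hd1 hkdvd) hk0, Nat.div_le_div_right hdD⟩
  · rintro ⟨k, d'⟩ hp
    simp only [Finset.mem_sigma, Finset.mem_filter, Finset.mem_Icc] at hp ⊢
    obtain ⟨⟨hk1, hkD⟩, hd1, hd'⟩ := hp
    have hk0 : 0 < k ^ 2 := by positivity
    refine ⟨⟨Nat.mul_pos hd1 hk0, (Nat.le_div_iff_mul_le hk0).1 hd'⟩, ⟨hk1, ?_⟩, Dvd.intro_left _ rfl⟩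
    calc k ≤ k ^ 2 := by nlinarith
      _ ≤ d' * k ^ 2 := Nat.le_mul_of_pos_left _ hd1
  · rintro ⟨d, k⟩ hp
    simp only [Finset.mem_sigma, Finset.mem_filter, Finset.mem_Icc] at hp
    obtain ⟨-, -, hkdvd⟩ := hp
    simp only [Nat.div_mul_cancel hkdvd]
  · rintro ⟨k, d'⟩ hp
    simp only [Finset.mem_sigma, Finset.mem_Icc] at hp
    obtain ⟨⟨hk1, -⟩, -, -⟩ := hp
    have hk0 : 0 < k ^ 2 := by positivity
    simp only [Nat.mul_div_cancel _ hk0]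
  · rintro ⟨d, k⟩ hp
    simp only [Finset.mem_sigma, Finset.mem_filter, Finset.mem_Icc] at hp
    obtain ⟨-, -, hkdvd⟩ := hp
    simp only
    rw [show d / k ^ 2 * (k ^ 2 * m) = d * m by rw [← mul_assoc, Nat.div_mul_cancel hkdvd]]
    ring

/-- `|R_q(x)| ≤ ∑_{d ≤ x/q} Λ(dq + h) ≤ (x/q) log(x + h)` (`q ≥ 1`, `x ≥ 0`, `h ≥ 1`). [folklore] -/
theorem abs_Rq_le {h q : ℕ} (hh : 1 ≤ h) (hq : 1 ≤ q) {x : ℝ} (hx : 0 ≤ x) :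
    |Rq h q x| ≤ x / q * Real.log (x + h) := by
  unfold Rq
  have hq0 : (0 : ℝ) < q := by exact_mod_cast hq
  calc |∑ d ∈ Icc 1 ⌊x / q⌋₊, (ArithmeticFunction.liouville d : ℝ) * Λ (d * q + h)|
      ≤ ∑ d ∈ Icc 1 ⌊x / q⌋₊, |(ArithmeticFunction.liouville d : ℝ) * Λ (d * q + h)| := Finset.abs_sum_le_sum_abs _ _
    _ ≤ ∑ d ∈ Icc 1 ⌊x / q⌋₊, Real.log (x + h) := by
        refine Finset.sum_le_sum fun d hd => ?_
        rw [abs_mul, abs_of_nonneg ArithmeticFunction.vonMangoldt_nonneg]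
        have hdx : (d : ℝ) * q ≤ x := by
          have := (Finset.mem_Icc.1 hd).2
          have h1 : (d : ℝ) ≤ x / q := le_trans (by exact_mod_cast this) (Nat.floor_le (by positivity))
          rwa [le_div_iff₀ hq0] at h1
        calc |(ArithmeticFunction.liouville d : ℝ)| * (Λ (d * q + h) : ℝ) ≤ 1 * Λ (d * q + h) :=
              mul_le_mul_of_nonneg_right (Literature.NumberTheory.Sieve.abs_liouville_le_one d) ArithmeticFunction.vonMangoldt_nonneg
          _ ≤ Real.log ((d * q + h : ℕ) : ℝ) := by rw [one_mul]; exact ArithmeticFunction.vonMangoldt_le_log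
          _ ≤ Real.log (x + h) := by
              refine Real.log_le_log (by positivity) ?_
              push_cast; linarith
    _ = (⌊x / q⌋₊ : ℝ) * Real.log (x + h) := by rw [Finset.sum_const, Nat.card_Icc, Nat.add_sub_cancel, nsmul_eq_mul]
    _ ≤ x / q * Real.log (x + h) := by
        have h1h : (1 : ℝ) ≤ h := by exact_mod_cast hh
        have hlog : 0 ≤ Real.log (x + h) := Real.log_nonneg (by linarith)
        exact mul_le_mul_of_nonneg_right (Nat.floor_le (by positivity)) hlog

/-- **`|R_q(x)| ≤ |T(x + h; q, h)|`** (`q ≥ 1`, `x ≥ 0`): the substitution `n = dq + h` and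
`λ(dq) = λ(d)λ(q)`. [folklore] -/
theorem abs_Rq_le_abs_Tcorr {h q : ℕ} (hq : 1 ≤ q) {x : ℝ} (hx : 0 ≤ x) :
    |Rq h q x| ≤ |Tcorr h q (x + h)| := by
  classical
  -- `T = λ(q) R`
  have hfl : ⌊x + h⌋₊ = ⌊x⌋₊ + h := Nat.floor_add_natCast hx h
  have hT : Tcorr h q (x + h) = (ArithmeticFunction.liouville q : ℝ) * Rq h q x := by
    unfold Tcorr Rq
    rw [hfl, Finset.mul_sum]
    -- bijection `d ↦ dq + h`
    symm
    refine Finset.sum_nbij' (fun d => d * q + h) (fun n => (n - h) / q) ?_ ?_ ?_ ?_ ?_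
    · intro d hd
      rw [Finset.mem_Icc] at hd
      rw [Finset.mem_filter, Finset.mem_Ioc]
      refine ⟨⟨?_, ?_⟩, ?_⟩
      · have : 1 ≤ d * q := Nat.one_le_iff_ne_zero.2 (Nat.mul_ne_zero (by omega) (by omega))
        omega
      · have hdq : d * q ≤ ⌊x⌋₊ := by
          have h1 : d ≤ ⌊x / q⌋₊ := hd.2
          rw [Nat.floor_div_natCast] at h1
          exact (Nat.le_div_iff_mul_le (by omega)).1 h1
        omega
      · exact ((Nat.modEq_iff_dvd' (by omega)).2 ⟨d, by rw [Nat.add_sub_cancel]; ring⟩).symm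
    · intro n hn
      rw [Finset.mem_filter, Finset.mem_Ioc] at hn
      rw [Finset.mem_Icc]
      obtain ⟨⟨hn1, hn2⟩, hmod⟩ := hn
      have hdvd : q ∣ n - h := (Nat.modEq_iff_dvd' hn1.le).1 hmod.symm
      constructor
      · -- `n - h ≥ q` since it is a positive multiple of `q`
        obtain ⟨c, hc⟩ := hdvd
        have hc0 : c ≠ 0 := by intro h0; rw [h0, mul_zero] at hc; omega
        rw [hc, Nat.mul_div_cancel_left _ (by omega)]; omega
      · rw [Nat.floor_div_natCast]
        exact Nat.div_le_div_right (by omega)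
    · intro d _
      show (d * q + h - h) / q = d
      rw [Nat.add_sub_cancel, Nat.mul_div_cancel _ (by omega)]
    · intro n hn
      rw [Finset.mem_filter, Finset.mem_Ioc] at hn
      obtain ⟨⟨hn1, -⟩, hmod⟩ := hn
      have hdvd : q ∣ n - h := (Nat.modEq_iff_dvd' hn1.le).1 hmod.symm
      show (n - h) / q * q + h = n
      rw [Nat.div_mul_cancel hdvd]; omega
    · intro d _
      unfold lamW
      have : Int.toNat (((d * q + h : ℕ) : ℤ) - h) = d * q := by
        push_cast
        rw [add_sub_cancel_right]
        exact_mod_cast Int.toNat_natCast (d * q)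
      rw [this, ArithmeticFunction.liouville_apply_mul]
      push_cast; ring
  rw [hT, abs_mul]
  have h1 : |(ArithmeticFunction.liouville q : ℝ)| = 1 := by
    rw [ArithmeticFunction.liouville_apply (by omega : q ≠ 0)]
    push_cast
    rw [abs_pow, abs_neg, abs_one, one_pow]
  rw [h1, one_mul]

end Summit.Parity.GeneralizedHardyLittlewood.Theorems.SieveToMAvg
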